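import Mathlib.RingTheory.PowerSeries.Derivative
import Mathlib.Algebra.Polynomial.BigOperators
import Mathlib.Data.Real.Basic
import HarnessLib

/-!
# Bürmann–Lagrange coefficients for Rains's shadow bounds — the power-series identities

Topic `Literature/InformationTheory/QuantumCodes` (venture QEC, cell `qec`, PARTITION row 06; LADDER-QEC rung X1).
This file is the formal-power-series ENGINE behind the three shadow-enumerator distance bounds of
[Rains1998Shadow] (Thm. 6: self-dual additive codes; Thm. 9: self-orthogonal additive codes `[[n,k,d]]`, `k ≥ 1`)
and [Rains1999Shadow] (Thm. 15: arbitrary `((n,K,d))`, `K > 1`), whose printed proofs compute coefficients of an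
invariant / anti-invariant expansion of the weight enumerator «by applying the Bürmann–Lagrange theorem»
[Rains1998Shadow, §III (Theorem (Bürmann–Lagrange)), §V Lemma 8]. We avoid the analytic theorem: every use of
it in the source is an instance of the elementary fact that the coefficient of `yⁱ` in `i·h − y·h′` vanishes
(Lemma 8 there, «[coeff. of `x^{i−j}` in `(i−j)h(x) − x h′(x)] = 0`»), which we prove for formal power
series over `ℝ` with Mathlib's `PowerSeries.derivative`.

Contents (all proved; column word: proved lemma):
* `wSeries c = (1 − y²)^{−(c+1)} = Σ_q C(q+c,c) y^{2q}` and its algebra: `(1 − y²)·wSeries (c+1) = wSeries c`,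
  `d/dy wSeries c = 2(c+1) y · wSeries (c+1)`; nonnegativity / positivity of the coefficients of
  `(1+y)^e · wSeries c` (the sign facts «`φ_{(2m−1)j}` … is positive whenever `l > 2`», «`φ_{(2m)j} > 0`» of
  [Rains1998Shadow, §V p. 138]).
* `coeff_euler`: `[yᴺ](N h − y h′) = 0`.
* `coeff_residue` («`φ_{ii} = 1`, `φ`-orthogonality»): `[yᵃ]((1 − 3y)(1 + y)^{3a} (1 − y²)^{−(a+1)}) = [a = 0]` —
  this is `[y^{i−j}](1+y)^{2i−n}(1−y)^{−i−1}` of [Rains1998Shadow, §V display after Lemma 8] tested against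
  the anti-invariant basis `(x−3y)(x+y)^{n−1−2i}(y(x−y))^i` of Thm. 7 there.
* `coeff_antiInvariant_basis`: `[yⁱ]((1 − 3y)^{2b+1}(1 + y)^{3i−2b}(1 − y²)^{−(i+1)}) = C(b,i)(−8)^i` — the same
  functional evaluated on `(x+y)^{n−2b−1}(x−3y)^{2b+1}`, using `(1−3y)² = (1+y)² − 8y(1−y)`.
* `coeff_buermannLagrange` («`α_i(n) = −(n/i)[coeff. of y^{i−1} in (1+y)^{2i−n−1}(1−y)^{−i}]`»,
  [Rains1998Shadow, §III–IV]): `i·[yⁱ]((1−3y)(1+y)^{3i−n}(1−y²)^{−(i+1)}) = −n·[y^{i−1}]((1+y)^{3i−n−1}(1−y²)^{−i})`.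

The LP-duality assembly (MacWilliams transform, the anti-invariant basis, the three bounds) is in
`ShadowDistanceBound.lean`. References: E. M. Rains, *Shadow bounds for self-dual codes*, IEEE Trans. Inform.
Theory 44 (1998) 134–139 [Rains1998Shadow] (read: galaxy pdf:-7810213031132736960, §§III–V); E. M. Rains,
*Quantum shadow enumerators*, IEEE Trans. Inform. Theory 45 (1999) 2361–2366 [Rains1999Shadow].
-/

namespace Literature.InformationTheory.QuantumCodes

open Finset PowerSeries

noncomputable section

namespace ShadowBound

/-! ### The series `(1 − y²)^{−(c+1)}` -/

/-- `wSeries c = (1 − y²)^{−(c+1)} = Σ_{q ≥ 0} C(q + c, c) y^{2q}` (as a formal power series over `ℝ`).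
Column: definition (auxiliary). [cite: Rains1998Shadow, §V p. 138 (the factors (1−y²)^{−2m}, (1−y²)^{−2m−1})] -/
def wSeries (c : ℕ) : ℝ⟦X⟧ :=
  PowerSeries.mk fun m => if Even m then (((m / 2 + c).choose c : ℕ) : ℝ) else 0

/-- Coefficients of `wSeries`. [cite: Rains1998Shadow, §V p. 138] -/
theorem coeff_wSeries (c m : ℕ) :
    coeff m (wSeries c) = if Even m then (((m / 2 + c).choose c : ℕ) : ℝ) else 0 := by
  rw [wSeries, coeff_mk]

/-- Even coefficients of `wSeries`. [cite: Rains1998Shadow, §V p. 138] -/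
theorem coeff_wSeries_two_mul (c r : ℕ) : coeff (2 * r) (wSeries c) = (((r + c).choose c : ℕ) : ℝ) := by
  rw [coeff_wSeries, if_pos (even_two_mul r), Nat.mul_div_cancel_left r (by norm_num)]

/-- Odd coefficients of `wSeries` vanish. [cite: Rains1998Shadow, §V p. 138] -/
theorem coeff_wSeries_two_mul_add_one (c r : ℕ) : coeff (2 * r + 1) (wSeries c) = 0 := by
  rw [coeff_wSeries, if_neg (Nat.not_even_two_mul_add_one r)]

/-- The coefficients of `wSeries` are nonnegative. [cite: Rains1998Shadow, §V p. 138] -/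
theorem coeff_wSeries_nonneg (c m : ℕ) : 0 ≤ coeff m (wSeries c) := by
  rw [coeff_wSeries]; split_ifs <;> positivity

/-- The even coefficients of `wSeries` are positive. [cite: Rains1998Shadow, §V p. 138] -/
theorem coeff_wSeries_pos (c : ℕ) {m : ℕ} (hm : Even m) : 0 < coeff m (wSeries c) := by
  rw [coeff_wSeries, if_pos hm]
  exact_mod_cast Nat.choose_pos (by omega)

/-- The constant coefficient of `wSeries c` is `1`. [cite: Rains1998Shadow, §V p. 138] -/
theorem constantCoeff_wSeries (c : ℕ) : constantCoeff (wSeries c) = 1 := by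
  rw [← coeff_zero_eq_constantCoeff_apply, show (0 : ℕ) = 2 * 0 by rfl, coeff_wSeries_two_mul]
  simp

/-- `[yᵐ]((1 − y²)·φ) = [yᵐ]φ − [y^{m−2}]φ`. [folklore] -/
private theorem coeff_one_sub_X_sq_mul (φ : ℝ⟦X⟧) (m : ℕ) :
    coeff m ((1 - X ^ 2) * φ) = coeff m φ - if 2 ≤ m then coeff (m - 2) φ else 0 := by
  rw [sub_mul, one_mul, map_sub, coeff_X_pow_mul']

/-- `(1 − y²)·(1 − y²)^{−(c+2)} = (1 − y²)^{−(c+1)}` (Pascal's rule). [folklore] -/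
private theorem one_sub_X_sq_mul_wSeries_succ (c : ℕ) : (1 - X ^ 2) * wSeries (c + 1) = wSeries c := by
  ext m
  rw [coeff_one_sub_X_sq_mul]
  obtain ⟨r, rfl | rfl⟩ := Nat.even_or_odd' m
  · rw [coeff_wSeries_two_mul, coeff_wSeries_two_mul]
    rcases r with _ | s
    · simp
    · rw [if_pos (by omega), show 2 * (s + 1) - 2 = 2 * s by omega, coeff_wSeries_two_mul,
        show s + 1 + (c + 1) = (s + c + 1) + 1 by ring, Nat.choose_succ_succ (s + c + 1) c,
        show s + (c + 1) = s + c + 1 by ring, show s + 1 + c = s + c + 1 by ring]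
      push_cast; ring
  · rw [coeff_wSeries_two_mul_add_one, coeff_wSeries_two_mul_add_one]
    split_ifs with h
    · rw [show 2 * r + 1 - 2 = 2 * (r - 1) + 1 by omega, coeff_wSeries_two_mul_add_one]; ring
    · ring

/-- `(1 − y²)^c · (1 − y²)^{−(c+a+1)} = (1 − y²)^{−(a+1)}`. [folklore] -/
private theorem one_sub_X_sq_pow_mul_wSeries (c a : ℕ) : (1 - X ^ 2) ^ c * wSeries (c + a) = wSeries a := by
  induction c with
  | zero => simp
  | succ c ih =>
    rw [pow_succ, mul_assoc, show c + 1 + a = (c + a) + 1 by ring, one_sub_X_sq_mul_wSeries_succ, ih]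

/-- `d/dy (1 − y²)^{−(c+1)} = 2(c+1)·y·(1 − y²)^{−(c+2)}`. [folklore] -/
private theorem derivative_wSeries (c : ℕ) :
    d⁄dX ℝ (wSeries c) = 2 * ((c : ℝ⟦X⟧) + 1) * X * wSeries (c + 1) := by
  ext m
  rw [coeff_derivative, show (2 * ((c : ℝ⟦X⟧) + 1) * X * wSeries (c + 1))
      = C (2 * ((c : ℝ) + 1)) * (X * wSeries (c + 1)) by
        rw [map_mul, map_add, map_natCast, map_one, map_ofNat]; ring, coeff_C_mul]
  obtain ⟨r, rfl | rfl⟩ := Nat.even_or_odd' m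
  · rw [coeff_wSeries_two_mul_add_one, zero_mul]
    rcases r with _ | s
    · simp
    · rw [show 2 * (s + 1) = (2 * s + 1) + 1 by ring, coeff_succ_X_mul, coeff_wSeries_two_mul_add_one,
        mul_zero]
  · rw [show 2 * r + 1 + 1 = 2 * (r + 1) by ring, coeff_wSeries_two_mul, coeff_succ_X_mul,
      coeff_wSeries_two_mul]
    have h := Nat.choose_succ_right_eq (r + c + 1) c
    rw [show r + c + 1 - c = r + 1 by omega] at h
    rw [show r + 1 + c = r + c + 1 by ring, show r + (c + 1) = r + c + 1 by ring]
    have h' : (((r + c + 1).choose (c + 1) : ℕ) : ℝ) * (c + 1) = ((r + c + 1).choose c : ℕ) * (r + 1) := by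
      exact_mod_cast h
    push_cast
    linear_combination (-2 : ℝ) * h'

/-! ### Coefficient extraction lemmas -/

/-- **Euler's identity at the level of coefficients**: `[yᴺ](N·h − y·h′) = 0` for every formal power series
`h` — the only content of the Bürmann–Lagrange theorem used in [Rains1998Shadow] (Lemma 8 there: «for any
function h(x), [coeff. of x^{i−j} in (i−j)h(x) − x h′(x)] = 0»). [cite: Rains1998Shadow, §V Lemma 8 (proof) p. 138] -/
theorem coeff_euler (h : ℝ⟦X⟧) (N : ℕ) : coeff N ((N : ℝ⟦X⟧) * h - X * d⁄dX ℝ h) = 0 := by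
  rw [map_sub, ← map_natCast (C (R := ℝ)) N, coeff_C_mul]
  rcases N with _ | N
  · simp
  · rw [coeff_succ_X_mul, coeff_derivative]; push_cast; ring

/-- `[yᴺ]((1 + y)^e) = C(e, N)` in `ℝ⟦y⟧`. [folklore] -/
private theorem coeff_one_add_X_pow (e N : ℕ) : coeff N ((1 + X : ℝ⟦X⟧) ^ e) = ((e.choose N : ℕ) : ℝ) := by
  rw [add_comm, add_pow, map_sum]
  simp_rw [one_pow, mul_one]
  rw [Finset.sum_eq_single N]
  · rw [mul_comm, ← map_natCast (C (R := ℝ)), coeff_C_mul, coeff_X_pow, if_pos rfl, mul_one]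
  · intro b _ hb
    rw [mul_comm, ← map_natCast (C (R := ℝ)), coeff_C_mul, coeff_X_pow, if_neg (Ne.symm hb), mul_zero]
  · intro hN
    rw [mem_range, not_lt] at hN
    rw [mul_comm, ← map_natCast (C (R := ℝ)), coeff_C_mul, Nat.choose_eq_zero_of_lt (by omega)]
    simp

/-- The coefficients of `(1 + y)^e (1 − y²)^{−(c+1)}` are nonnegative («`φ_{(2m−1)j}` … for `l = 2`, it is
nonnegative»). [cite: Rains1998Shadow, §V p. 138] -/
theorem coeff_one_add_X_pow_mul_wSeries_nonneg (e c N : ℕ) :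
    0 ≤ coeff N ((1 + X : ℝ⟦X⟧) ^ e * wSeries c) := by
  rw [coeff_mul]
  exact sum_nonneg fun p _ => mul_nonneg (by rw [coeff_one_add_X_pow]; positivity) (coeff_wSeries_nonneg _ _)

/-- The coefficient of `yᴺ` in `(1 + y)^e (1 − y²)^{−(c+1)}` is positive when `N` is even or `e ≥ 1` («This is
positive whenever `l > 2`»; «`φ_{(2m)j} = [coeff. of y^{2m−j} in (1+y)³(1−y²)^{−2m−1}] > 0`»).
[cite: Rains1998Shadow, §V p. 138] -/
theorem coeff_one_add_X_pow_mul_wSeries_pos {e c N : ℕ} (h : Even N ∨ 1 ≤ e) :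
    0 < coeff N ((1 + X : ℝ⟦X⟧) ^ e * wSeries c) := by
  rw [coeff_mul]
  have hnn : ∀ p ∈ antidiagonal N, 0 ≤ coeff p.1 ((1 + X : ℝ⟦X⟧) ^ e) * coeff p.2 (wSeries c) :=
    fun p _ => mul_nonneg (by rw [coeff_one_add_X_pow]; positivity) (coeff_wSeries_nonneg _ _)
  by_cases hN : Even N
  · refine lt_of_lt_of_le ?_ (Finset.single_le_sum hnn (mem_antidiagonal.mpr (zero_add N) : ((0, N) : ℕ × ℕ) ∈ _))
    rw [coeff_one_add_X_pow, Nat.choose_zero_right, Nat.cast_one, one_mul]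
    exact coeff_wSeries_pos c hN
  · have he : 1 ≤ e := h.resolve_left hN
    obtain ⟨r, hr⟩ : ∃ r, N = 2 * r + 1 := by
      obtain ⟨r, rfl | rfl⟩ := Nat.even_or_odd' N
      · exact absurd (even_two_mul r) hN
      · exact ⟨r, rfl⟩
    refine lt_of_lt_of_le ?_
      (Finset.single_le_sum hnn (mem_antidiagonal.mpr (by omega) : ((1, 2 * r) : ℕ × ℕ) ∈ _))
    rw [coeff_one_add_X_pow, Nat.choose_one_right]
    exact mul_pos (by exact_mod_cast he) (coeff_wSeries_pos c (even_two_mul r))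

/-- **The residue identity** (orthogonality of Rains's coefficients `φ_{ij}` against the anti-invariant basis of
his Thm. 7): `[yᵃ]((1 − 3y)(1 + y)^{3a}(1 − y²)^{−(a+1)}) = [a = 0]`. Proof: with `R = (1+y)^{3a}(1−y²)^{−a}` one
has `a·(1−3y)(1+y)^{3a}(1−y²)^{−(a+1)} = a·R − y·R′`, whose `yᵃ`-coefficient vanishes (`coeff_euler`).
[cite: Rains1998Shadow, §V Lemma 8 and the display «φ_{ij} = [coeff. of y^{i−j} in (1+y)^{2i−n}(1−y)^{−i−1}]» p. 138] -/
theorem coeff_residue (a : ℕ) :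
    coeff a ((1 - 3 * X) * (1 + X) ^ (3 * a) * wSeries a) = if a = 0 then (1 : ℝ) else 0 := by
  rcases a with _ | e
  · simp [coeff_zero_eq_constantCoeff, constantCoeff_wSeries]
  · rw [if_neg (Nat.succ_ne_zero e)]
    set P : ℝ⟦X⟧ := (1 + X) ^ (3 * e + 2) with hP
    have hpow : ((1 + X : ℝ⟦X⟧)) ^ (3 * (e + 1)) = P * (1 + X) := by
      rw [show 3 * (e + 1) = (3 * e + 2) + 1 by ring, pow_succ]
    have hdP : d⁄dX ℝ (P * (1 + X)) = (3 * (e : ℝ⟦X⟧) + 3) * P := by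
      rw [← pow_succ, derivative_pow, map_add, Derivation.map_one_eq_zero, derivative_X, zero_add, mul_one,
        show 3 * e + 2 + 1 - 1 = 3 * e + 2 by omega, ← hP]
      push_cast; ring
    -- R = (1+y)^{3a} · (1−y²)^{−a}
    have hkey : ((e : ℝ⟦X⟧) + 1) * ((1 - 3 * X) * (1 + X) ^ (3 * (e + 1)) * wSeries (e + 1))
        = ((e : ℝ⟦X⟧) + 1) * (P * (1 + X) * wSeries e) - X * d⁄dX ℝ (P * (1 + X) * wSeries e) := by
      rw [Derivation.leibniz, smul_eq_mul, smul_eq_mul, derivative_wSeries, hdP,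
        ← one_sub_X_sq_mul_wSeries_succ e, hpow]
      ring
    have h := coeff_euler (P * (1 + X) * wSeries e) (e + 1)
    push_cast at h
    rw [← hkey, show ((e : ℝ⟦X⟧) + 1) = C ((e : ℝ) + 1) by
      rw [map_add, map_natCast, map_one], coeff_C_mul] at h
    rcases mul_eq_zero.mp h with h0 | h0
    · exact absurd h0 (by positivity)
    · exact h0

/-- **The functional `[yⁱ]((1+y)^{3i+1−n}(1−y²)^{−(i+1)} · —)` on the anti-invariant basis**: for `2b ≤ 3i`,
`[yⁱ]((1 − 3y)^{2b+1}(1 + y)^{3i−2b}(1 − y²)^{−(i+1)}) = C(b,i)·(−8)^i`. Proof: `(1−3y)² = (1+y)² − 8y(1−y)`,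
binomial expansion, and `coeff_residue` term by term. (This evaluates Rains's coefficient functional `e_i` of
Thm. 7 on `(x+y)^{n−2b−1}(x−3y)^{2b+1} = Σ_c C(b,c)(−8)^c (x−3y)(x+y)^{n−1−2c}(y(x−y))^c`.)
[cite: Rains1998Shadow, §V Thm. 7 and the computation of φ_{ij} p. 138] -/
theorem coeff_antiInvariant_basis (b i : ℕ) (h : 2 * b ≤ 3 * i) :
    coeff i ((1 - 3 * X) ^ (2 * b + 1) * (1 + X) ^ (3 * i - 2 * b) * wSeries i)
      = ((b.choose i : ℕ) : ℝ) * (-8) ^ i := by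
  have hsq : ((1 - 3 * X : ℝ⟦X⟧)) ^ 2 = (-8) * (X * (1 - X)) + (1 + X) ^ 2 := by ring
  rw [pow_succ, pow_mul, hsq, add_pow, sum_mul, sum_mul, sum_mul, map_sum]
  have hterm : ∀ c ∈ range (b + 1),
      coeff i ((-8 * (X * (1 - X))) ^ c * ((1 + X) ^ 2) ^ (b - c) * ((b.choose c : ℕ) : ℝ⟦X⟧) * (1 - 3 * X)
        * (1 + X) ^ (3 * i - 2 * b) * wSeries i)
        = if c = i then ((b.choose i : ℕ) : ℝ) * (-8) ^ i else 0 := by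
    intro c hc
    rw [mem_range] at hc
    have hreassoc : (-8 * (X * (1 - X))) ^ c * ((1 + X : ℝ⟦X⟧) ^ 2) ^ (b - c) * ((b.choose c : ℕ) : ℝ⟦X⟧)
        * (1 - 3 * X) * (1 + X) ^ (3 * i - 2 * b) * wSeries i
        = C (((b.choose c : ℕ) : ℝ) * (-8) ^ c)
          * (X ^ c * ((1 - 3 * X) * ((1 - X) ^ c * (1 + X) ^ (3 * i - 2 * c)) * wSeries i)) := by
      rw [map_mul, map_natCast, map_pow, map_neg, map_ofNat, ← pow_mul, mul_pow, mul_pow,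
        show (1 + X : ℝ⟦X⟧) ^ (3 * i - 2 * c) = (1 + X) ^ (2 * (b - c)) * (1 + X) ^ (3 * i - 2 * b) by
          rw [← pow_add]; congr 1; omega]
      ring
    rw [hreassoc, coeff_C_mul, coeff_X_pow_mul']
    by_cases hci : c ≤ i
    · obtain ⟨a, rfl⟩ := Nat.exists_eq_add_of_le hci
      rw [if_pos hci, Nat.add_sub_cancel_left,
        show (1 - X : ℝ⟦X⟧) ^ c * (1 + X) ^ (3 * (c + a) - 2 * c) = (1 - X ^ 2) ^ c * (1 + X) ^ (3 * a) by
          rw [show 3 * (c + a) - 2 * c = c + 3 * a by omega, pow_add, ← mul_assoc, ← mul_pow]; ring,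
        show (1 - 3 * X) * ((1 - X ^ 2) ^ c * (1 + X : ℝ⟦X⟧) ^ (3 * a)) * wSeries (c + a)
          = (1 - 3 * X) * (1 + X) ^ (3 * a) * ((1 - X ^ 2) ^ c * wSeries (c + a)) by ring,
        one_sub_X_sq_pow_mul_wSeries, coeff_residue]
      rcases a with _ | a
      · simp
      · rw [if_neg (Nat.succ_ne_zero a), if_neg (by omega), mul_zero]
    · rw [if_neg hci, if_neg (by omega), mul_zero]
  rw [sum_congr rfl hterm, sum_ite_eq' (range (b + 1)) i]
  split_ifs with hi
  · rfl
  · rw [mem_range, not_lt] at hi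
    rw [Nat.choose_eq_zero_of_lt (by omega)]; simp

/-- **Bürmann–Lagrange form of the leading coefficient** («`α_i(n) = −(n/i)·[coeff. of y^{i−1} in
(1+y)^{2i−n−1}(1−y)^{−i}]`» versus Lemma 8's «`[coeff. of y^{i} in (1−3y)(1+y)^{2i−1−n}(1−y)^{−i−1}]`»): for
`1 ≤ i` and `n + 1 ≤ 3i`,
`i·[yⁱ]((1−3y)(1+y)^{3i−n}(1−y²)^{−(i+1)}) = −n·[y^{i−1}]((1+y)^{3i−n−1}(1−y²)^{−i})`.
[cite: Rains1998Shadow, §III (formula for α_i(n) via Bürmann–Lagrange) and §V Lemma 8, pp. 136–138] -/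
theorem coeff_buermannLagrange (n i : ℕ) (hi : 1 ≤ i) (hn : n + 1 ≤ 3 * i) :
    (i : ℝ) * coeff i ((1 - 3 * X) * (1 + X) ^ (3 * i - n) * wSeries i)
      = -(n : ℝ) * coeff (i - 1) ((1 + X) ^ (3 * i - n - 1) * wSeries (i - 1)) := by
  obtain ⟨i, rfl⟩ := Nat.exists_eq_add_of_le hi
  rw [show 1 + i = i + 1 by ring] at hn ⊢
  rw [Nat.add_sub_cancel]
  set p := 3 * (i + 1) - n - 1 with hp
  have hp1 : 3 * (i + 1) - n = p + 1 := by omega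
  have hcast : (n : ℝ⟦X⟧) = 3 * (i : ℝ⟦X⟧) + 2 - p := by
    have : (n : ℝ) = 3 * i + 2 - p := by
      have h3 : p + 1 + n = 3 * i + 3 := by omega
      have h4 : ((p : ℝ) + 1) + n = 3 * i + 3 := by exact_mod_cast h3
      linarith
    rw [← map_natCast (C (R := ℝ)) n, this, map_sub, map_add, map_mul, map_natCast, map_natCast, map_ofNat,
      map_ofNat]
  rw [hp1]
  set P : ℝ⟦X⟧ := (1 + X) ^ p with hP
  have hdP : d⁄dX ℝ (P * (1 + X)) = ((p : ℝ⟦X⟧) + 1) * P := by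
    rw [← pow_succ, derivative_pow, map_add, Derivation.map_one_eq_zero, derivative_X, zero_add, mul_one,
      Nat.add_sub_cancel, ← hP]
    push_cast; ring
  -- h = (1+y)^{p+1} (1−y²)^{−(i+1)} ;  i' h − y h′ = i' (1−3y)(1+y)^{p+1} w (i+1) + n y (1+y)^p w i
  have hkey : ((i : ℝ⟦X⟧) + 1) * ((1 - 3 * X) * (P * (1 + X)) * wSeries (i + 1))
        + (n : ℝ⟦X⟧) * (X * (P * wSeries i))
        = ((i : ℝ⟦X⟧) + 1) * (P * (1 + X) * wSeries i) - X * d⁄dX ℝ (P * (1 + X) * wSeries i) := by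
    rw [Derivation.leibniz, smul_eq_mul, smul_eq_mul, derivative_wSeries, hdP,
      ← one_sub_X_sq_mul_wSeries_succ i, hcast]
    ring
  have h := coeff_euler (P * (1 + X) * wSeries i) (i + 1)
  push_cast at h
  rw [← hkey, map_add, show ((i : ℝ⟦X⟧) + 1) = C ((i : ℝ) + 1) by rw [map_add, map_natCast, map_one],
    coeff_C_mul, ← map_natCast (C (R := ℝ)) n, coeff_C_mul, coeff_succ_X_mul] at h
  rw [pow_succ, ← hP]
  push_cast
  linear_combination h

end ShadowBound

end

end Literature.InformationTheory.QuantumCodes
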